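import Summits.AtomisticToContinuum.FouriersLaw.Theorems.VanishingNoiseTransferNoiseLocalityStubResponseDensityNoisyDyson4
import Summits.AtomisticToContinuum.FouriersLaw.Theorems.VanishingNoiseTransferVanishingNoiseBoundFlipGibbsAdjoint

/-!
# Flip-noisy response density, step 5: detailed balance of the equilibrium resolvent kernel and
symmetry of the flips against the Gibbs measure (helpers for stub `stub_responseDensityNoisy`)

Helper file `--supports stmt-AtomisticToContinuum-11975` (crux `NoiseLocality`, route
`VanishingNoiseTransfer`, line `relative-flip-energy-transfer`, stub 1b `stub_responseDensityNoisy`),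
namespace `…NoiseLocality.StubResponseDensityNoisy.Dyson`.

Both baths at `T > 0`, `π_T` the Gibbs measure, `Θ(q,p) = (q,-p)`, weight `e^{ϑH}` with `0 < ϑ`,
`2ϑ < 1/(2T)`; `R = R_r` the resolvent kernel of the equilibrium transition semigroup,
`Q F = N⁻¹ ∑_i F ∘ momentumFlip i`. For continuous `F, G` with `|F|, |G| ≤ C e^{ϑH}`:

* `integral_weight_mul_resolvent` — `∫ e^{-H/T} G · R F dx = ∫ (∫ e^{-H/T} G · P_t F dx) Exp_r(dt)`
  (Fubini; any baths in `(0, 2T]`);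
* `resolvent_detailedBalance` — `∫ e^{-H/T} G · R F dx = ∫ e^{-H/T} (F∘Θ) · R(G∘Θ) dx` (the
  detailed balance `pinnedChain_detailedBalance` of the equilibrium kernels, averaged in time);
* `integral_gibbs_mul_resolvent_dual` — the same against `π_T`: `π_T(G · R F) = π_T((R(G∘Θ))∘Θ · F)`;
* `integral_gibbs_mul_flipAverage` — `π_T(G · Q F) = π_T(Q G · F)`;
  `gibbsMeasure_bind_flipKernel` — `π_T Q = π_T`.

No definitions.
-/

noncomputable section

open MeasureTheory ProbabilityTheory Filter Topology Set
open scoped NNReal ENNReal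

namespace Summit.AtomisticToContinuum.FouriersLaw.Theorems.NoiseLocality.StubResponseDensityNoisy.Dyson

open Literature.MathematicalPhysics.KineticTheory.HeatConduction
open Literature.Probability.Process Literature.MathematicalPhysics.KineticTheory OscillatorChain

variable {N : ℕ}

/-! ### Flips and the Gibbs measure -/

/-- The Gibbs measure is `Q`-invariant: `π_T Q = π_T` (each flip preserves `π_T`). -/
theorem gibbsMeasure_bind_flipKernel (P : OscillatorChain) (N : ℕ) (T : ℝ) :
    (P.gibbsMeasure N T).bind (flipKernel N) = P.gibbsMeasure N T := by
  rcases Nat.eq_zero_or_pos N with rfl | hN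
  · change (P.gibbsMeasure 0 T).bind Kernel.id = _
    simp only [Kernel.id, Kernel.deterministic]
    exact Measure.bind_dirac
  · refine Measure.ext fun s hs => ?_
    rw [Measure.bind_apply hs (Kernel.aemeasurable _)]
    simp_rw [flipKernel_apply hN, Measure.smul_apply, Measure.finsetSum_apply, smul_eq_mul,
      Measure.dirac_apply' _ hs]
    have hmi : ∀ i : Fin N, Measurable fun x : PhaseSpace N => s.indicator (1 : PhaseSpace N → ℝ≥0∞)
        (momentumFlip i x) := fun i => (measurable_one.indicator hs).comp (measurable_momentumFlip i)
    rw [lintegral_const_mul _ (Finset.measurable_sum _ fun i _ => hmi i),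
      lintegral_finsetSum _ fun i _ => hmi i]
    have h1 : ∀ i : Fin N, ∫⁻ x, s.indicator 1 (momentumFlip i x) ∂(P.gibbsMeasure N T) =
        P.gibbsMeasure N T s := fun i => by
      rw [(P.measurePreserving_momentumFlip_gibbsMeasure N T i).lintegral_comp
        (measurable_one.indicator hs), lintegral_indicator_one hs]
    simp_rw [h1]
    rw [Finset.sum_const, Finset.card_univ, Fintype.card_fin, nsmul_eq_mul, ← mul_assoc,
      ENNReal.inv_mul_cancel (Nat.cast_ne_zero.2 hN.ne') (ENNReal.natCast_ne_top N), one_mul]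

/-- **`Q` is symmetric against the Gibbs measure**: `π_T(G · Q F) = π_T(Q G · F)` whenever the
products `G · (F ∘ momentumFlip i)` are `π_T`-integrable (each flip preserves `π_T` and is an
involution, `integral_mul_comp_momentumFlip`). -/
theorem integral_gibbs_mul_flipAverage (P : OscillatorChain) (N : ℕ) (T : ℝ) {F G : PhaseSpace N → ℝ}
    (hint : ∀ i : Fin N, Integrable (fun x => G x * F (momentumFlip i x)) (P.gibbsMeasure N T)) :
    ∫ x, G x * ((N : ℝ)⁻¹ * ∑ i : Fin N, F (momentumFlip i x)) ∂(P.gibbsMeasure N T) =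
      ∫ x, ((N : ℝ)⁻¹ * ∑ i : Fin N, G (momentumFlip i x)) * F x ∂(P.gibbsMeasure N T) := by
  have hflip : ∀ i : Fin N, ∫ x, G x * F (momentumFlip i x) ∂(P.gibbsMeasure N T) =
      ∫ x, G (momentumFlip i x) * F x ∂(P.gibbsMeasure N T) := fun i =>
    integral_mul_comp_momentumFlip (P.measurePreserving_momentumFlip_gibbsMeasure N T i) F G
  have hint' : ∀ i : Fin N, Integrable (fun x => G (momentumFlip i x) * F x) (P.gibbsMeasure N T) := by
    intro i
    have h := (integrable_comp_momentumFlip_iff (P.measurePreserving_momentumFlip_gibbsMeasure N T i)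
      (f := fun x => G x * F (momentumFlip i x))).2 (hint i)
    simpa only [momentumFlip_momentumFlip] using h
  have hL : ∀ x, G x * ((N : ℝ)⁻¹ * ∑ i : Fin N, F (momentumFlip i x)) =
      (N : ℝ)⁻¹ * ∑ i : Fin N, G x * F (momentumFlip i x) := fun x => by
    rw [← Finset.mul_sum]; ring
  have hR : ∀ x, ((N : ℝ)⁻¹ * ∑ i : Fin N, G (momentumFlip i x)) * F x =
      (N : ℝ)⁻¹ * ∑ i : Fin N, G (momentumFlip i x) * F x := fun x => by
    rw [← Finset.sum_mul]; ring
  simp_rw [hL, hR]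
  rw [integral_const_mul, integral_const_mul, integral_finsetSum _ fun i _ => hint i,
    integral_finsetSum _ fun i _ => hint' i]
  simp_rw [hflip]

/-! ### Detailed balance of the equilibrium resolvent kernel -/

section Dual

variable {ω₂ lam β γ : ℝ} (hω : 0 < ω₂) (hl : 0 < lam) (hβ : 0 < β) (hγ : 0 < γ) (hN : 0 < N)
  {T : ℝ} (hT : 0 < T) {ϑ : ℝ} (hϑ : 0 < ϑ) (h2ϑT : 2 * ϑ < 1 / (2 * T)) {r : ℝ} (hr : 0 < r)
include hω hl hβ hγ hN hT hϑ h2ϑT hr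

/-- **Time-averaging a Gibbs-weighted pairing**: for baths `T_L, T_R ∈ (0, 2T]`, continuous `F, G`
with `|F| ≤ C_F e^{ϑH}`, `|G| ≤ C_G e^{ϑH}`:
`∫ e^{-H/T} G · R_r F dx = ∫ (∫ e^{-H/T} G · P_{t⁺} F dx) Exp_r(dt)`, all integrals converging
absolutely (Fubini with the uniform orbit bound of `…Dyson1`; `2ϑ < 1/(2T)`). -/
theorem integral_weight_mul_resolvent {T_L T_R : ℝ} (hL : 0 < T_L) (hL' : T_L ≤ 2 * T) (hR : 0 < T_R)
    (hR' : T_R ≤ 2 * T) {F G : PhaseSpace N → ℝ} (hF : Continuous F) (hG : Continuous G) {CF CG : ℝ}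
    (hFb : ∀ y, |F y| ≤ CF * Real.exp (ϑ * (pinnedChain ω₂ lam β γ).hamiltonian N y))
    (hGb : ∀ y, |G y| ≤ CG * Real.exp (ϑ * (pinnedChain ω₂ lam β γ).hamiltonian N y)) :
    Integrable (fun x => Real.exp (-1 / T * (pinnedChain ω₂ lam β γ).hamiltonian N x) * G x *
        ∫ y, F y ∂((pinnedChainSemigroup hω hl.le hβ.le hγ.le hN hL.le hR.le).resolventKernel r x)) ∧
    ∫ x, Real.exp (-1 / T * (pinnedChain ω₂ lam β γ).hamiltonian N x) * G x *
        ∫ y, F y ∂((pinnedChainSemigroup hω hl.le hβ.le hγ.le hN hL.le hR.le).resolventKernel r x) =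
      ∫ t, (∫ x, Real.exp (-1 / T * (pinnedChain ω₂ lam β γ).hamiltonian N x) * G x *
        ∫ y, F y ∂((pinnedChain ω₂ lam β γ).transitionKernel N T_L T_R t.toNNReal x)) ∂(expMeasure r) := by
  -- adapted from `resolvent_response_identity_of_contDiff` (…Dyson4)
  set Pc := pinnedChain ω₂ lam β γ with hPc
  set Hm := Pc.hamiltonian N with hHm
  have hHc : Continuous Hm := pinnedChain_continuous_hamiltonian ω₂ lam β γ N
  set Sg := pinnedChainSemigroup hω hl.le hβ.le hγ.le hN hL.le hR.le with hSg
  set Rk := Sg.resolventKernel r with hRk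
  haveI := isProbabilityMeasure_expMeasure hr
  haveI : IsMarkovKernel Rk := Sg.isMarkovKernel_resolventKernel hr
  set ρ := expMeasure r with hρ
  have hϑT : ϑ < 1 / (2 * T) := by linarith
  have h2θ : -1 / T + 2 * ϑ < 0 := by
    have h1 : 2 * ϑ < 1 / T := h2ϑT.trans (by rw [one_div_lt_one_div (by positivity) hT]; linarith)
    have : -1 / T + 2 * ϑ = 2 * ϑ - 1 / T := by ring
    rw [this]; linarith
  have hCF : 0 ≤ CF := by
    have := (abs_nonneg _).trans (hFb 0); exact nonneg_of_mul_nonneg_left this (Real.exp_pos _)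
  have hCG : 0 ≤ CG := by
    have := (abs_nonneg _).trans (hGb 0); exact nonneg_of_mul_nonneg_left this (Real.exp_pos _)
  have hWm : Measurable fun z => Real.exp (ϑ * Hm z) :=
    (Real.continuous_exp.comp (continuous_const.mul hHc)).measurable
  obtain ⟨c, B, a, b, hc, hB, ha, hb, hunif⟩ :=
    lintegral_exp_kernel_resolventKernel_le_unif hω hl hβ hγ hN hT hϑ hϑT hr
  obtain ⟨hPt, hRes⟩ := hunif T_L T_R hL hL' hR hR'
  set PF : ℝ≥0 × PhaseSpace N → ℝ := fun p => ∫ y, F y ∂(Pc.transitionKernel N T_L T_R p.1 p.2) with hPF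
  have hPFm : Measurable PF := pinnedChain_measurable_integral_kernel_uncurry hω hl.le hβ.le hγ.le N _ _
    hF.stronglyMeasurable
  have hPFb : ∀ (t : ℝ≥0) (x : PhaseSpace N), |PF (t, x)| ≤ CF * (c.toReal * Real.exp (ϑ * Hm x) + B.toReal) := by
    intro t x
    have h := (integrable_abs_integral_le_of_lintegral_le hWm (fun z => (Real.exp_pos _).le)
      (ENNReal.add_ne_top.2 ⟨ENNReal.mul_ne_top hc ENNReal.ofReal_ne_top, hB⟩) (hPt t x)
      hF.aestronglyMeasurable hCF hFb).2
    rwa [toReal_affine hc hB (Real.exp_pos _).le] at h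
  have hRFI : ∀ x, Integrable F (Rk x) := fun x =>
    (integrable_abs_integral_le_of_lintegral_le hWm (fun z => (Real.exp_pos _).le)
      (ENNReal.add_ne_top.2 ⟨ENNReal.mul_ne_top ha.ne_top ENNReal.ofReal_ne_top, hb⟩) (hRes x)
      hF.aestronglyMeasurable hCF hFb).1
  have hRF_eq : ∀ x, ∫ y, F y ∂(Rk x) = ∫ t, PF (t.toNNReal, x) ∂ρ := fun x =>
    integral_resolventKernel_of_integrable Sg hr x hF.stronglyMeasurable (hRFI x)
  -- domination
  set D : PhaseSpace N → ℝ := fun x => CG * CF * (c.toReal * Real.exp ((-1 / T + 2 * ϑ) * Hm x) +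
    B.toReal * Real.exp ((-1 / T + ϑ) * Hm x)) with hD
  have hDi : Integrable D := by
    have h1 := integrable_exp_mul_hamiltonian hω hl.le hβ.le γ h2θ (N := N)
    have h2 := integrable_exp_mul_hamiltonian hω hl.le hβ.le γ (c := -1 / T + ϑ) (by linarith) (N := N)
    exact ((h1.const_mul c.toReal).add (h2.const_mul B.toReal)).const_mul (CG * CF)
  have hdom : ∀ (t : ℝ≥0) (x : PhaseSpace N), |Real.exp (-1 / T * Hm x) * G x * PF (t, x)| ≤ D x := by
    intro t x
    rw [abs_mul, abs_mul, abs_of_pos (Real.exp_pos _), hD]; dsimp only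
    have hc0 := ENNReal.toReal_nonneg (a := c); have hB0 := ENNReal.toReal_nonneg (a := B)
    rw [show (-1 / T + 2 * ϑ) * Hm x = -1 / T * Hm x + ϑ * Hm x + ϑ * Hm x by ring,
      show (-1 / T + ϑ) * Hm x = -1 / T * Hm x + ϑ * Hm x by ring, Real.exp_add, Real.exp_add]
    have hw := Real.exp_pos (-1 / T * Hm x)
    have he := Real.exp_pos (ϑ * Hm x)
    calc Real.exp (-1 / T * Hm x) * |G x| * |PF (t, x)|
        ≤ Real.exp (-1 / T * Hm x) * (CG * Real.exp (ϑ * Hm x)) * (CF * (c.toReal * Real.exp (ϑ * Hm x) + B.toReal)) :=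
          mul_le_mul (mul_le_mul_of_nonneg_left (hGb x) hw.le) (hPFb t x) (abs_nonneg _) (by positivity)
      _ = _ := by ring
  have him : Measurable fun p : ℝ × PhaseSpace N => Real.exp (-1 / T * Hm p.2) * G p.2 * PF (p.1.toNNReal, p.2) :=
    (((Real.continuous_exp.comp (continuous_const.mul hHc)).mul hG).measurable.comp measurable_snd).mul
      (hPFm.comp ((measurable_real_toNNReal.comp measurable_fst).prodMk measurable_snd))
  have hprod : Integrable (Function.uncurry fun (t : ℝ) (x : PhaseSpace N) =>
      Real.exp (-1 / T * Hm x) * G x * PF (t.toNNReal, x)) (ρ.prod volume) :=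
    (hDi.comp_snd ρ).mono' him.aestronglyMeasurable
      (Eventually.of_forall fun p => by rw [Real.norm_eq_abs]; exact hdom _ p.2)
  have e : ∀ x, Real.exp (-1 / T * Hm x) * G x * ∫ y, F y ∂(Rk x) =
      ∫ t, Real.exp (-1 / T * Hm x) * G x * PF (t.toNNReal, x) ∂ρ := fun x => by
    rw [hRF_eq x]; exact (integral_const_mul _ _).symm
  constructor
  · -- integrability of the resolvent pairing
    exact hprod.integral_prod_right.congr (Eventually.of_forall fun x => (e x).symm)
  · calc ∫ x, Real.exp (-1 / T * Hm x) * G x * ∫ y, F y ∂(Rk x)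
        = ∫ x, ∫ t, Real.exp (-1 / T * Hm x) * G x * PF (t.toNNReal, x) ∂ρ := integral_congr_ae (Eventually.of_forall e)
      _ = _ := (integral_integral_swap hprod).symm

/-- **Detailed balance of the equilibrium resolvent kernel** (both baths at `T`): for continuous
`F, G` with `|F|, |G| ≤ C e^{ϑH}`,
`∫ e^{-H/T} G · R_r F dx = ∫ e^{-H/T} (F∘Θ) · R_r (G∘Θ) dx`, `Θ(q,p) = (q,-p)`
(`pinnedChain_detailedBalance` under the exponential time). -/
theorem resolvent_detailedBalance {F G : PhaseSpace N → ℝ} (hF : Continuous F) (hG : Continuous G)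
    {CF CG : ℝ} (hFb : ∀ y, |F y| ≤ CF * Real.exp (ϑ * (pinnedChain ω₂ lam β γ).hamiltonian N y))
    (hGb : ∀ y, |G y| ≤ CG * Real.exp (ϑ * (pinnedChain ω₂ lam β γ).hamiltonian N y)) :
    ∫ x, Real.exp (-1 / T * (pinnedChain ω₂ lam β γ).hamiltonian N x) * G x *
        ∫ y, F y ∂((pinnedChainSemigroup hω hl.le hβ.le hγ.le hN hT.le hT.le).resolventKernel r x) =
      ∫ x, Real.exp (-1 / T * (pinnedChain ω₂ lam β γ).hamiltonian N x) * F (x.1, -x.2) *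
        ∫ y, G (y.1, -y.2) ∂((pinnedChainSemigroup hω hl.le hβ.le hγ.le hN hT.le hT.le).resolventKernel r x) := by
  have hT2 : T ≤ 2 * T := by linarith
  have h2ϑ : 2 * ϑ < 1 / T := h2ϑT.trans (by rw [one_div_lt_one_div (by positivity) hT]; linarith)
  have hΘ : Continuous fun x : PhaseSpace N => (x.1, -x.2) := continuous_fst.prodMk continuous_snd.neg
  have hFΘ : Continuous fun x : PhaseSpace N => F (x.1, -x.2) := hF.comp hΘ
  have hGΘ : Continuous fun x : PhaseSpace N => G (x.1, -x.2) := hG.comp hΘ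
  have hFΘb : ∀ y : PhaseSpace N, |F (y.1, -y.2)| ≤ CF * Real.exp (ϑ * (pinnedChain ω₂ lam β γ).hamiltonian N y) :=
    fun y => by have h := hFb (y.1, -y.2); rwa [OscillatorChain.hamiltonian_neg_momentum] at h
  have hGΘb : ∀ y : PhaseSpace N, |G (y.1, -y.2)| ≤ CG * Real.exp (ϑ * (pinnedChain ω₂ lam β γ).hamiltonian N y) :=
    fun y => by have h := hGb (y.1, -y.2); rwa [OscillatorChain.hamiltonian_neg_momentum] at h
  rw [(integral_weight_mul_resolvent hω hl hβ hγ hN hT hϑ h2ϑT hr hT hT2 hT hT2 hF hG hFb hGb).2,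
    (integral_weight_mul_resolvent hω hl hβ hγ hN hT hϑ h2ϑT hr hT hT2 hT hT2 hGΘ hFΘ hGΘb hFΘb).2]
  refine integral_congr_ae (Eventually.of_forall fun t => ?_)
  exact pinnedChain_detailedBalance hω hl.le hβ.le hγ hN hT hϑ h2ϑ hF hG hFb hGb t.toNNReal

/-- **Duality of the equilibrium resolvent against the Gibbs measure**: for continuous `F, G` with
`|F|, |G| ≤ C e^{ϑH}`, `π_T(G · R_r F) = π_T((R_r (G∘Θ))∘Θ · F)`. -/
theorem integral_gibbs_mul_resolvent_dual {F G : PhaseSpace N → ℝ} (hF : Continuous F) (hG : Continuous G)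
    {CF CG : ℝ} (hFb : ∀ y, |F y| ≤ CF * Real.exp (ϑ * (pinnedChain ω₂ lam β γ).hamiltonian N y))
    (hGb : ∀ y, |G y| ≤ CG * Real.exp (ϑ * (pinnedChain ω₂ lam β γ).hamiltonian N y)) :
    ∫ x, G x * (∫ y, F y ∂((pinnedChainSemigroup hω hl.le hβ.le hγ.le hN hT.le hT.le).resolventKernel r x))
        ∂((pinnedChain ω₂ lam β γ).gibbsMeasure N T) =
      ∫ x, (∫ y, G (y.1, -y.2) ∂((pinnedChainSemigroup hω hl.le hβ.le hγ.le hN hT.le hT.le).resolventKernel r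
        (x.1, -x.2))) * F x ∂((pinnedChain ω₂ lam β γ).gibbsMeasure N T) := by
  set Pc := pinnedChain ω₂ lam β γ with hPc
  set Rk := (pinnedChainSemigroup hω hl.le hβ.le hγ.le hN hT.le hT.le).resolventKernel r with hRk
  have hρ : ∀ x, Pc.gibbsDensity N T x = Real.exp (-1 / T * Pc.hamiltonian N x) := fun x => by
    simp only [OscillatorChain.gibbsDensity]; congr 1; ring
  -- the right-hand side after the change of variables `x ↦ Θ x`
  have hcv := integral_comp_momentumReversal N fun x =>
    (∫ y, G (y.1, -y.2) ∂(Rk (x.1, -x.2))) * F x * Pc.gibbsDensity N T x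
  simp only [neg_neg, Prod.mk.eta, OscillatorChain.gibbsDensity, OscillatorChain.hamiltonian_neg_momentum] at hcv
  rw [Pc.integral_gibbsMeasure, Pc.integral_gibbsMeasure]
  congr 1
  simp only [OscillatorChain.gibbsDensity] at hcv ⊢
  rw [← hcv]
  have h := resolvent_detailedBalance hω hl hβ hγ hN hT hϑ h2ϑT hr hF hG hFb hGb
  have e1 : ∀ x : PhaseSpace N, G x * (∫ y, F y ∂(Rk x)) * Real.exp (-Pc.hamiltonian N x / T) =
      Real.exp (-1 / T * Pc.hamiltonian N x) * G x * ∫ y, F y ∂(Rk x) := fun x => by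
    rw [show -Pc.hamiltonian N x / T = -1 / T * Pc.hamiltonian N x by ring]; ring
  have e2 : ∀ x : PhaseSpace N, (∫ y, G (y.1, -y.2) ∂(Rk x)) * F (x.1, -x.2) * Real.exp (-Pc.hamiltonian N x / T) =
      Real.exp (-1 / T * Pc.hamiltonian N x) * F (x.1, -x.2) * ∫ y, G (y.1, -y.2) ∂(Rk x) := fun x => by
    rw [show -Pc.hamiltonian N x / T = -1 / T * Pc.hamiltonian N x by ring]; ring
  simp_rw [e1, e2]
  exact h

end Dual

/-- Registered helper sub-goal `helper_responseDensityNoisyDysonResolventDual` of stmt-AtomisticToContinuum-11975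
(= `integral_gibbs_mul_resolvent_dual`, fully quantified one-line form). -/
theorem helper_responseDensityNoisyDysonResolventDual : ∀ (ω₂ lam β γ : ℝ) (hω : 0 < ω₂) (hl : 0 < lam) (hβ : 0 < β) (hγ : 0 < γ) (N : ℕ) (hN : 0 < N) (T : ℝ) (hT : 0 < T) (ϑ : ℝ), 0 < ϑ → 2 * ϑ < 1 / (2 * T) → ∀ (r : ℝ), 0 < r → ∀ (F G : Literature.MathematicalPhysics.KineticTheory.HeatConduction.PhaseSpace N → ℝ), Continuous F → Continuous G → ∀ (CF CG : ℝ), (∀ y, |F y| ≤ CF * Real.exp (ϑ * (Literature.MathematicalPhysics.KineticTheory.HeatConduction.pinnedChain ω₂ lam β γ).hamiltonian N y)) → (∀ y, |G y| ≤ CG * Real.exp (ϑ * (Literature.MathematicalPhysics.KineticTheory.HeatConduction.pinnedChain ω₂ lam β γ).hamiltonian N y)) → ∫ x, G x * (∫ y, F y ∂((Literature.MathematicalPhysics.KineticTheory.HeatConduction.pinnedChainSemigroup hω hl.le hβ.le hγ.le hN hT.le hT.le).resolventKernel r x)) ∂((Literature.MathematicalPhysics.KineticTheory.HeatConduction.pinnedChain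 ω₂ lam β γ).gibbsMeasure N T) = ∫ x, (∫ y, G (y.1, -y.2) ∂((Literature.MathematicalPhysics.KineticTheory.HeatConduction.pinnedChainSemigroup hω hl.le hβ.le hγ.le hN hT.le hT.le).resolventKernel r (x.1, -x.2))) * F x ∂((Literature.MathematicalPhysics.KineticTheory.HeatConduction.pinnedChain ω₂ lam β γ).gibbsMeasure N T) :=
  fun _ _ _ _ hω hl hβ hγ _ hN _ hT _ hϑ h2ϑT _ hr _ _ hF hG _ _ hFb hGb =>
    integral_gibbs_mul_resolvent_dual hω hl hβ hγ hN hT hϑ h2ϑT hr hF hG hFb hGb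

end Summit.AtomisticToContinuum.FouriersLaw.Theorems.NoiseLocality.StubResponseDensityNoisy.Dyson

end
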